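import Summits.NavierStokesRegularity.NavierStokesRegularity.Theorems.TypeILiouvilleTypeIliouvilleLWeakL3Recurrence
import HarnessLib

/-!
# Weak-`L³` slices are automatically in the heat form of `Ḃ^{-1}_{∞,∞}` (crux `TypeIliouvilleL`,
# stmt-NavierStokesRegularity-10661, persistent stub S3ᵐ): Albritton–Barker's slice condition (a)
# discharged at the recurrence times

Helper file (theorems only, no definition, no named fact, no `sorry`; lands
`--supports stmt-NavierStokesRegularity-10661`). Companion of
`TypeILiouvilleTypeIliouvilleLWeakL3Recurrence`: there, Albritton–Barker 2019 Thm 4.1 is applied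
with the final slice `v(t₀) − b` assumed to satisfy (a) `√σ ‖e^{σΔ}(v(t₀) − b)‖_∞ ≤ A` and the
blow-down (b). Here (a) is DISCHARGED whenever the slice itself is weak-`L³`:

* `lintegral_ofReal_indicator_norm_le_of_weakL3` — layer cake for the high part of a weak-`L³`
  function: `∫_{λ < |f|} |f| ≤ 3M/(2λ²)` if `s³·vol{s < |f|} ≤ M` for all `s > 0`;
* `sqrt_mul_norm_heatExtension_le_of_weakL3` — the heat-form `Ḃ^{-1}_{∞,∞}` bound
  `√σ ‖e^{σΔ} f(x)‖ ≤ M + 2` for every such `f` (split `|f| ≤ λ + |f|𝟙_{λ<|f|}` at the level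
  `λ = (M+1)/√σ`, mass one and the sup bound `(4πσ)^{-3/2}` of the Gauss–Weierstrass kernel);
* `oseenMild_const_of_backward_weakL3_const_at_recurrence` — the slab theorem
  `oseenMild_const_of_backward_weakL3_const_slab` with `t₀ = τ_{k₀}` a recurrence time and
  hypothesis (a) removed: a mild bounded ancient solution with a uniform weak-`L³` bound of
  `v(τ_k) − b` along `τ_k → −∞` whose slice `v(τ_{k₀}) − b` blows down (condition (b), stated on the
  Galilean translate by `τ_{k₀} b`) is the constant `b` on the whole slab.

What is NOT removed: the blow-down condition (b) (it fails for `−1`-homogeneous tails, which are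
weak-`L³`; Albritton–Barker's `ε(M)`). Nothing here proves S3ᵐ, (L), or anything about
Navier–Stokes regularity.
-/

set_option linter.dupNamespace false

namespace Summit.NavierStokesRegularity.NavierStokesRegularity.Theorems

open MeasureTheory Filter Set Function
open scoped ENNReal NNReal Topology RealInnerProductSpace
open Literature.Analysis Literature.Analysis.FluidPDE

/-- **Layer cake for the high part of a weak-`L³` function.** If `f` is a.e.-strongly measurable
on `ℝ³` with `s³ · vol{x : s < ‖f x‖} ≤ M < ∞` for all `s > 0`, then for every `λ > 0`
`∫_{λ < ‖f‖} ‖f‖ ≤ 3M/(2λ²)` (Cavalieri: the distribution function of `‖f‖𝟙_{λ<‖f‖}` at height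
`t` is `vol{max(λ,t) < ‖f‖} ≤ M / max(λ,t)³`, and `∫₀^∞ max(λ,t)⁻³ dt = 3/(2λ²)`).
[cite: Grafakos2014, proof of Thm 1.3.2 (splitting a weak-type function at a level)] -/
theorem lintegral_ofReal_indicator_norm_le_of_weakL3 {F : Type*} [NormedAddCommGroup F]
    {f : EuclideanSpace ℝ (Fin 3) → F} (hf : AEStronglyMeasurable f volume)
    {M : ℝ≥0∞} (hM : M ≠ ∞)
    (hweak : ∀ s : ℝ, 0 < s →
      ENNReal.ofReal s ^ 3 * (volume : Measure (EuclideanSpace ℝ (Fin 3))) {x | s < ‖f x‖} ≤ M)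
    {lam : ℝ} (hlam : 0 < lam) :
    ∫⁻ x, ENNReal.ofReal ((Ioi lam).indicator id ‖f x‖) ≤
      ENNReal.ofReal (3 * M.toReal / (2 * lam ^ 2)) := by
  set m : ℝ := M.toReal with hm
  have hm0 : 0 ≤ m := ENNReal.toReal_nonneg
  -- the layer-cake integrand
  set g : EuclideanSpace ℝ (Fin 3) → ℝ := fun x => (Ioi lam).indicator id ‖f x‖ with hg
  have hg_nn : 0 ≤ᵐ[volume] g := Eventually.of_forall fun x => by
    simp only [hg, Pi.zero_apply]
    by_cases hx : ‖f x‖ ∈ Ioi lam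
    · rw [indicator_of_mem hx]; exact norm_nonneg _
    · rw [indicator_of_notMem hx]
  have hg_meas : AEMeasurable g volume := by
    have h1 : Measurable fun r : ℝ => (Ioi lam).indicator id r :=
      measurable_id.indicator measurableSet_Ioi
    exact h1.comp_aemeasurable hf.norm.aemeasurable
  -- distribution function of `g`
  have hdist : ∀ t : ℝ, 0 < t →
      (volume : Measure (EuclideanSpace ℝ (Fin 3))) {x | t < g x} ≤
        ENNReal.ofReal (m / (max lam t) ^ 3) := by
    intro t ht
    have hs : 0 < max lam t := lt_max_of_lt_left hlam
    have hsub : {x | t < g x} ⊆ {x | max lam t < ‖f x‖} := by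
      intro x hx
      simp only [mem_setOf_eq, hg] at hx ⊢
      by_cases hxm : ‖f x‖ ∈ Ioi lam
      · rw [indicator_of_mem hxm] at hx
        exact max_lt hxm hx
      · rw [indicator_of_notMem hxm] at hx
        exact absurd hx (not_lt.2 ht.le)
    have h1 := hweak (max lam t) hs
    have hs3 : ENNReal.ofReal (max lam t) ^ 3 ≠ 0 :=
      pow_ne_zero _ (ENNReal.ofReal_pos.2 hs).ne'
    have hs3' : ENNReal.ofReal (max lam t) ^ 3 ≠ ∞ :=
      ENNReal.pow_ne_top ENNReal.ofReal_ne_top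
    calc (volume : Measure (EuclideanSpace ℝ (Fin 3))) {x | t < g x}
        ≤ volume {x | max lam t < ‖f x‖} := measure_mono hsub
      _ ≤ M / ENNReal.ofReal (max lam t) ^ 3 := by
          rw [ENNReal.le_div_iff_mul_le (Or.inl hs3) (Or.inl hs3'), mul_comm]
          exact h1
      _ = ENNReal.ofReal (m / (max lam t) ^ 3) := by
          rw [hm, ENNReal.ofReal_div_of_pos (pow_pos hs 3), ENNReal.ofReal_toReal hM,
            ENNReal.ofReal_pow hs.le]
  -- Cavalieri
  rw [lintegral_eq_lintegral_meas_lt volume hg_nn hg_meas]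
  -- split `(0,∞) ⊆ (0,λ] ∪ (λ,∞)`
  have hsplit : Ioi (0 : ℝ) ⊆ Ioc 0 lam ∪ Ioi lam := by
    intro t ht
    rcases le_or_gt t lam with h | h
    · exact Or.inl ⟨ht, h⟩
    · exact Or.inr h
  have hlow : ∫⁻ t in Ioc (0 : ℝ) lam, (volume : Measure (EuclideanSpace ℝ (Fin 3))) {x | t < g x}
      ≤ ENNReal.ofReal (m / lam ^ 2) := by
    calc ∫⁻ t in Ioc (0 : ℝ) lam, (volume : Measure (EuclideanSpace ℝ (Fin 3))) {x | t < g x}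
        ≤ ∫⁻ _ in Ioc (0 : ℝ) lam, ENNReal.ofReal (m / lam ^ 3) := by
          refine setLIntegral_mono' measurableSet_Ioc fun t ht => ?_
          have h := hdist t ht.1
          rwa [max_eq_left ht.2] at h
      _ = ENNReal.ofReal (m / lam ^ 3) * volume (Ioc (0 : ℝ) lam) := setLIntegral_const _ _
      _ = ENNReal.ofReal (m / lam ^ 2) := by
          rw [Real.volume_Ioc, sub_zero, ← ENNReal.ofReal_mul (by positivity)]
          congr 1
          field_simp
  have hhigh : ∫⁻ t in Ioi lam, (volume : Measure (EuclideanSpace ℝ (Fin 3))) {x | t < g x}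
      ≤ ENNReal.ofReal (m / (2 * lam ^ 2)) := by
    have hint : IntegrableOn (fun t : ℝ => m * t ^ (-3 : ℝ)) (Ioi lam) volume :=
      (integrableOn_Ioi_rpow_of_lt (by norm_num) hlam).const_mul m
    calc ∫⁻ t in Ioi lam, (volume : Measure (EuclideanSpace ℝ (Fin 3))) {x | t < g x}
        ≤ ∫⁻ t in Ioi lam, ENNReal.ofReal (m * t ^ (-3 : ℝ)) := by
          refine setLIntegral_mono' measurableSet_Ioi fun t ht => ?_
          have ht0 : 0 < t := hlam.trans ht
          have h := hdist t ht0
          rw [max_eq_right (le_of_lt ht)] at h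
          refine h.trans (le_of_eq ?_)
          congr 1
          rw [Real.rpow_neg ht0.le, div_eq_mul_inv]
          norm_cast
      _ = ENNReal.ofReal (∫ t in Ioi lam, m * t ^ (-3 : ℝ)) := by
          rw [ofReal_integral_eq_lintegral_ofReal hint]
          refine (ae_restrict_iff' measurableSet_Ioi).2 (Eventually.of_forall fun t ht => ?_)
          exact mul_nonneg hm0 (Real.rpow_nonneg (hlam.trans ht).le _)
      _ = ENNReal.ofReal (m / (2 * lam ^ 2)) := by
          rw [integral_const_mul, integral_Ioi_rpow_of_lt (by norm_num) hlam]
          congr 1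
          have h2 : lam ^ (-3 + 1 : ℝ) = (lam ^ 2)⁻¹ := by
            rw [show (-3 + 1 : ℝ) = -2 by norm_num, Real.rpow_neg hlam.le]
            norm_cast
          rw [h2]
          field_simp
          ring
  calc ∫⁻ t in Ioi (0 : ℝ), (volume : Measure (EuclideanSpace ℝ (Fin 3))) {x | t < g x}
      ≤ ∫⁻ t in Ioc (0 : ℝ) lam ∪ Ioi lam, (volume : Measure (EuclideanSpace ℝ (Fin 3))) {x | t < g x} :=
        lintegral_mono_set hsplit
    _ ≤ (∫⁻ t in Ioc (0 : ℝ) lam, (volume : Measure (EuclideanSpace ℝ (Fin 3))) {x | t < g x}) +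
          ∫⁻ t in Ioi lam, (volume : Measure (EuclideanSpace ℝ (Fin 3))) {x | t < g x} :=
        lintegral_union_le _ _ _
    _ ≤ ENNReal.ofReal (m / lam ^ 2) + ENNReal.ofReal (m / (2 * lam ^ 2)) := add_le_add hlow hhigh
    _ = ENNReal.ofReal (3 * m / (2 * lam ^ 2)) := by
        rw [← ENNReal.ofReal_add (by positivity) (by positivity)]
        congr 1
        field_simp
        ring

/-- **Weak-`L³` functions lie in the heat form of `Ḃ^{-1}_{∞,∞}`, with an explicit constant.**
If `f : ℝ³ → F` is a.e.-strongly measurable with `s³ · vol{x : s < ‖f x‖} ≤ M < ∞` for all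
`s > 0` (uniform weak-`L³` bound), then for every `σ > 0` and every `x`,
`√σ · ‖(e^{σΔ} f)(x)‖ ≤ M + 2`. Proof: `‖e^{σΔ}f(x)‖ ≤ ∫ K_σ(y)‖f(x−y)‖ dy`, split
`‖f‖ ≤ λ + ‖f‖𝟙_{λ<‖f‖}` with `λ = (M+1)/√σ`; the first part contributes `λ` (mass one), the
second at most `(4πσ)^{-3/2} · 3M/(2λ²) ≤ 1/√σ` (`lintegral_ofReal_indicator_norm_le_of_weakL3`,
`(4πσ)^{-3/2} ≤ σ^{-3/2}`, `3M ≤ 2(M+1)²`). This is the heat-kernel form of the embedding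
`L^{3,∞} ⊂ Ḃ^{-1}_{∞,∞}` used by Albritton–Barker 2019 §4 (class `𝔹`).
[cite: AlbrittonBarker2019, §4 before Thm 4.1 (arXiv:1811.00502 p. 9); BahouriCheminDanchin2011, Thm 2.34] -/
theorem sqrt_mul_norm_heatExtension_le_of_weakL3 {F : Type*} [NormedAddCommGroup F]
    [NormedSpace ℝ F] [CompleteSpace F]
    {f : EuclideanSpace ℝ (Fin 3) → F} (hf : AEStronglyMeasurable f volume)
    {M : ℝ≥0∞} (hM : M ≠ ∞)
    (hweak : ∀ s : ℝ, 0 < s →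
      ENNReal.ofReal s ^ 3 * (volume : Measure (EuclideanSpace ℝ (Fin 3))) {x | s < ‖f x‖} ≤ M)
    {σ : ℝ} (hσ : 0 < σ) (x : EuclideanSpace ℝ (Fin 3)) :
    Real.sqrt σ * ‖UnboundedOperators.heatExtension f σ x‖ ≤ M.toReal + 2 := by
  set m : ℝ := M.toReal with hm
  have hm0 : 0 ≤ m := ENNReal.toReal_nonneg
  have hsq : 0 < Real.sqrt σ := Real.sqrt_pos.2 hσ
  set lam : ℝ := (m + 1) / Real.sqrt σ with hlam_def
  have hlam : 0 < lam := div_pos (by linarith) hsq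
  -- the kernel constant
  set Cσ : ℝ := (4 * Real.pi * σ) ^ (-(Module.finrank ℝ (EuclideanSpace ℝ (Fin 3)) : ℝ) / 2) with hCσ
  have hCσ0 : 0 ≤ Cσ := by rw [hCσ]; positivity
  set g : EuclideanSpace ℝ (Fin 3) → ℝ := fun z => (Ioi lam).indicator id ‖f z‖ with hg
  have hg0 : ∀ z, 0 ≤ g z := fun z => by
    simp only [hg]
    by_cases hz : ‖f z‖ ∈ Ioi lam
    · rw [indicator_of_mem hz]; exact norm_nonneg _
    · rw [indicator_of_notMem hz]
  -- pointwise splitting of `‖f‖`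
  have hsplit : ∀ z, ‖f z‖ₑ ≤ ENNReal.ofReal lam + ENNReal.ofReal (g z) := by
    intro z
    rw [← ofReal_norm]
    by_cases hz : ‖f z‖ ∈ Ioi lam
    · simp only [hg, indicator_of_mem hz, id]
      exact le_add_self
    · have hle : ‖f z‖ ≤ lam := not_lt.1 hz
      exact (ENNReal.ofReal_le_ofReal hle).trans le_self_add
  -- pointwise bound of the convolution integrand
  have hK : ∀ y, ‖UnboundedOperators.heatKernel σ y • f (x - y)‖ₑ ≤
      ‖UnboundedOperators.heatKernel (E := EuclideanSpace ℝ (Fin 3)) σ y‖ₑ * ENNReal.ofReal lam +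
        ENNReal.ofReal Cσ * ENNReal.ofReal (g (x - y)) := by
    intro y
    rw [enorm_smul]
    have hKy : ‖UnboundedOperators.heatKernel (E := EuclideanSpace ℝ (Fin 3)) σ y‖ₑ ≤ ENNReal.ofReal Cσ := by
      rw [Real.enorm_eq_ofReal (UnboundedOperators.heatKernel_pos hσ y).le]
      exact ENNReal.ofReal_le_ofReal (UnboundedOperators.heatKernel_le hσ y)
    calc ‖UnboundedOperators.heatKernel (E := EuclideanSpace ℝ (Fin 3)) σ y‖ₑ * ‖f (x - y)‖ₑ
        ≤ ‖UnboundedOperators.heatKernel (E := EuclideanSpace ℝ (Fin 3)) σ y‖ₑ *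
            (ENNReal.ofReal lam + ENNReal.ofReal (g (x - y))) := by gcongr; exact hsplit _
      _ = ‖UnboundedOperators.heatKernel (E := EuclideanSpace ℝ (Fin 3)) σ y‖ₑ * ENNReal.ofReal lam +
            ‖UnboundedOperators.heatKernel (E := EuclideanSpace ℝ (Fin 3)) σ y‖ₑ * ENNReal.ofReal (g (x - y)) :=
          mul_add _ _ _
      _ ≤ _ := by gcongr
  -- the high part, integrated: layer cake
  have hhigh : ∫⁻ y, ENNReal.ofReal (g (x - y)) ≤ ENNReal.ofReal (3 * m / (2 * lam ^ 2)) := by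
    rw [lintegral_sub_left_eq_self (fun z => ENNReal.ofReal (g z)) x]
    exact lintegral_ofReal_indicator_norm_le_of_weakL3 hf hM hweak hlam
  -- assemble the `ℝ≥0∞` bound
  have hmeasK : Measurable fun y : EuclideanSpace ℝ (Fin 3) =>
      ‖UnboundedOperators.heatKernel (E := EuclideanSpace ℝ (Fin 3)) σ y‖ₑ * ENNReal.ofReal lam :=
    (UnboundedOperators.continuous_heatKernel σ).measurable.enorm.mul_const _
  have hE : ‖UnboundedOperators.heatExtension f σ x‖ₑ ≤
      ENNReal.ofReal (lam + Cσ * (3 * m / (2 * lam ^ 2))) := by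
    rw [UnboundedOperators.heatExtension_apply]
    calc ‖∫ y, UnboundedOperators.heatKernel σ y • f (x - y)‖ₑ
        ≤ ∫⁻ y, ‖UnboundedOperators.heatKernel σ y • f (x - y)‖ₑ := enorm_integral_le_lintegral_enorm _
      _ ≤ ∫⁻ y, ‖UnboundedOperators.heatKernel (E := EuclideanSpace ℝ (Fin 3)) σ y‖ₑ * ENNReal.ofReal lam +
            ENNReal.ofReal Cσ * ENNReal.ofReal (g (x - y)) := lintegral_mono hK
      _ = (∫⁻ y, ‖UnboundedOperators.heatKernel (E := EuclideanSpace ℝ (Fin 3)) σ y‖ₑ * ENNReal.ofReal lam) +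
            ∫⁻ y, ENNReal.ofReal Cσ * ENNReal.ofReal (g (x - y)) := lintegral_add_left hmeasK _
      _ = ENNReal.ofReal lam + ENNReal.ofReal Cσ * ∫⁻ y, ENNReal.ofReal (g (x - y)) := by
          rw [lintegral_mul_const _ (UnboundedOperators.continuous_heatKernel σ).measurable.enorm,
            UnboundedOperators.lintegral_enorm_heatKernel hσ, one_mul,
            lintegral_const_mul' _ _ ENNReal.ofReal_ne_top]
      _ ≤ ENNReal.ofReal lam + ENNReal.ofReal Cσ * ENNReal.ofReal (3 * m / (2 * lam ^ 2)) :=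
          by gcongr
      _ = ENNReal.ofReal (lam + Cσ * (3 * m / (2 * lam ^ 2))) := by
          rw [← ENNReal.ofReal_mul hCσ0, ← ENNReal.ofReal_add hlam.le (by positivity)]
  -- the real arithmetic: `Cσ · 3m/(2λ²) ≤ 1/√σ`
  have hfin : (Module.finrank ℝ (EuclideanSpace ℝ (Fin 3)) : ℝ) = 3 := by
    simp [finrank_euclideanSpace]
  have hCσ_le : Cσ ≤ (σ * Real.sqrt σ)⁻¹ := by
    have h1 : Cσ ≤ σ ^ (-(3 : ℝ) / 2) := by
      rw [hCσ, hfin]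
      refine Real.rpow_le_rpow_of_nonpos hσ ?_ (by norm_num)
      have : (1 : ℝ) ≤ 4 * Real.pi := by
        have := Real.pi_gt_three; linarith
      nlinarith
    have h2 : σ ^ (-(3 : ℝ) / 2) = (σ * Real.sqrt σ)⁻¹ := by
      rw [show (-(3 : ℝ) / 2) = -((3 : ℝ) / 2) by ring, Real.rpow_neg hσ.le,
        show ((3 : ℝ) / 2) = 1 + 1 / 2 by norm_num, Real.rpow_add hσ, Real.rpow_one,
        Real.sqrt_eq_rpow]
    exact h1.trans h2.le
  have hlam_sq : lam ^ 2 = (m + 1) ^ 2 / σ := by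
    rw [hlam_def, div_pow, Real.sq_sqrt hσ.le]
  have hreal : lam + Cσ * (3 * m / (2 * lam ^ 2)) ≤ (m + 2) / Real.sqrt σ := by
    have hfrac : 3 * m / (2 * lam ^ 2) ≤ σ := by
      rw [hlam_sq, div_le_iff₀ (by positivity)]
      have : 3 * m ≤ 2 * (m + 1) ^ 2 := by nlinarith
      calc 3 * m ≤ 2 * (m + 1) ^ 2 := this
        _ = σ * (2 * ((m + 1) ^ 2 / σ)) := by field_simp
    have hprod : Cσ * (3 * m / (2 * lam ^ 2)) ≤ (σ * Real.sqrt σ)⁻¹ * σ :=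
      mul_le_mul hCσ_le hfrac (by positivity) (by positivity)
    have hsimp : (σ * Real.sqrt σ)⁻¹ * σ = 1 / Real.sqrt σ := by
      field_simp
    calc lam + Cσ * (3 * m / (2 * lam ^ 2)) ≤ lam + 1 / Real.sqrt σ := by linarith [hprod.trans hsimp.le]
      _ = (m + 2) / Real.sqrt σ := by rw [hlam_def]; field_simp; ring
  -- back to real norms
  have hnorm : ‖UnboundedOperators.heatExtension f σ x‖ ≤ (m + 2) / Real.sqrt σ := by
    have h := hE.trans (ENNReal.ofReal_le_ofReal hreal)
    rw [← ofReal_norm] at h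
    exact (ENNReal.ofReal_le_ofReal_iff (by positivity)).1 h
  calc Real.sqrt σ * ‖UnboundedOperators.heatExtension f σ x‖
      ≤ Real.sqrt σ * ((m + 2) / Real.sqrt σ) := mul_le_mul_of_nonneg_left hnorm hsq.le
    _ = m + 2 := by field_simp

/-- **Weak-`L³` recurrence with blow-down at ONE recurrence time kills a mild bounded ancient
solution on the whole slab — Albritton–Barker's slice condition (a) discharged.** Let `v` be
continuous and uniformly bounded on `(−∞,0) × ℝ³`, weakly divergence free on every slice and
Oseen-mild, with negative times `τ_k → −∞` and a finite `M` such that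
`s³ · vol{x : s < ‖v(τ_k,x) − b‖} ≤ M` for all `s > 0` and all `k`. If at ONE index `k₀` the slice
blows down — `∫ ⟪λ (v(τ_{k₀})(λx + τ_{k₀}b) − b), φ(x)⟫ dx → 0` as `λ → ∞` for every smooth compactly
supported `φ` — then `v(t,x) = b` for all `t < 0` and all `x`. Proof:
`oseenMild_const_of_backward_weakL3_const_slab` at `t₀ = τ_{k₀}`, its hypothesis (a) being
`sqrt_mul_norm_heatExtension_le_of_weakL3` for the weak-`L³` slice `v(τ_{k₀}) − b`.
[cite: AlbrittonBarker2019, Thm 4.1 (arXiv:1811.00502 §4 p. 9)] -/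
theorem oseenMild_const_of_backward_weakL3_const_at_recurrence
    (v : ℝ → EuclideanSpace ℝ (Fin 3) → EuclideanSpace ℝ (Fin 3)) (b : EuclideanSpace ℝ (Fin 3))
    (hvc : ContinuousOn (uncurry v) (Iio 0 ×ˢ univ))
    (hvK : ∃ K : ℝ, ∀ t < 0, ∀ x, ‖v t x‖ ≤ K)
    (hvd : ∀ t < 0, IsWeaklyDivFree (v t))
    (hvm : ∀ s t : ℝ, s < t → t < 0 → ∀ x,
      v t x = UnboundedOperators.heatExtension (v s) (t - s) x - oseenDuhamel 1 s v v t x)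
    {τ : ℕ → ℝ} {M : ℝ≥0∞} (hM : M < ∞) (hτ : Tendsto τ atTop atBot) (hτ0 : ∀ k, τ k < 0)
    (hwk : ∀ (k : ℕ) (s : ℝ), 0 < s →
      ENNReal.ofReal s ^ 3 *
        (volume : Measure (EuclideanSpace ℝ (Fin 3))) {x | s < ‖v (τ k) x - b‖} ≤ M)
    {k₀ : ℕ}
    (hB : ∀ φ : EuclideanSpace ℝ (Fin 3) → EuclideanSpace ℝ (Fin 3),
      FunctionSpaces.IsTestFunctionOn (⊤ : TopologicalSpace.Opens (EuclideanSpace ℝ (Fin 3))) φ →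
      Tendsto (fun lam : ℝ => ∫ x, ⟪lam • (v (τ k₀) (lam • x + τ k₀ • b) - b), φ x⟫) atTop (𝓝 0)) :
    ∀ t < 0, ∀ x, v t x = b := by
  -- the slice `v(τ k₀) − b` is continuous, hence a.e.-strongly measurable
  have hcont : Continuous fun y => v (τ k₀) y - b := by
    have h1 : Continuous (v (τ k₀)) :=
      hvc.comp_continuous (continuous_const.prodMk continuous_id) fun y => ⟨hτ0 k₀, mem_univ y⟩
    exact h1.sub continuous_const
  have hA : ∃ A : ℝ, ∀ σ : ℝ, 0 < σ → ∀ x,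
      Real.sqrt σ * ‖UnboundedOperators.heatExtension (fun y => v (τ k₀) y - b) σ x‖ ≤ A :=
    ⟨M.toReal + 2, fun σ hσ x =>
      sqrt_mul_norm_heatExtension_le_of_weakL3 hcont.aestronglyMeasurable hM.ne (hwk k₀) hσ x⟩
  exact oseenMild_const_of_backward_weakL3_const_slab v b hvc hvK hvd hvm
    ⟨τ, M, hM, hτ, hτ0, hwk⟩ (hτ0 k₀) hA hB

end Summit.NavierStokesRegularity.NavierStokesRegularity.Theorems
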